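import Literature.MathematicalPhysics.QuantumFieldTheory.Balaban1983to89.B16Eq18Proof
import Literature.MathematicalPhysics.QuantumFieldTheory.Balaban1983to89.B16Sect1Kernels

/-!
# `Balaban1983to89.B16Ineq178Box` — T. Bałaban, *Large field renormalization. II. Localization, exponentiation, and bounds for the 𝐑 operation*, Commun. Math. Phys. **122** (1989) 355–392 [Balaban1989LargeFieldII], (1.78) p. 383 "by the same remark as in the case of the inequality (1.8)": the ONE-BOND tree-gauge Poincaré inequality PROVED on the carrier of (1.8) — a rectangular parallelepiped `Λ` in its comb (axial) gauge (`B16Eq18Proof`), with the pointwise constant `(d−1)(K−1)` and hence the printed `6(d+3)(100M(L+1)N^{β₀}R_j)^{d+2}`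

statement-level skeleton of published theorems with citation tags; proofs where landed; nothing here is a claim about the Yang–Mills mass gap

PDF held: `paper:balaban1989-cmp122-large-field-ii` (journal page = PDF page + 354; p. 383 = PDF p. 29, render re-read as an
image `run/shared/lean/pub/pub-balaban/b2b-balaban-ref1/pages/1989-cmp122-large-field-II/…-p029-x2.png`; p. 358 = PDF p. 4).

WHAT IS REPRODUCED (mega-formalization `lit-balaban`, HOME `run/shared/lean/pub/lit-balaban/`, reader/typer seat r13,
generation 5; SKELETON row **B16.Eq1.78**, decl of record `B16Sect1Kernels.Ineq178`; companion of
`B16Ineq178TreeGauge` (the same row on the [IV] p. 196 annulus gauge); referee ref-5).  P. 383, verbatim: *"We have to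
bound one bond variable |B(b)|² by the quadratic form. By the same remark as in the case of the inequality (1.8), we get
|B(b)|² ≦ 6(d + 3)(100M(L + 1)N^{β₀}R_j)^{d+2} Σ_{p′∈𝐁₀∩Ω″~_{h+1}} |(∂B)(p′)|², (1.78) for a bond b ∈ 𝐁₀ ∩ Ω″~_{h+1}."*
The remark in the case of (1.8), p. 358: *"Using the fact that Λ is a rectangular parallelepiped contained in a cube of
the size 100M, and that G₀ determines the axial gauge in Λ, we obtain the inequality … It follows by the same simple
argument as in the proof of Lemma 2.4 in [11]"*.

THE THEOREM (kind «model-instance»: the (1.8) carrier of `B16Eq18Proof` — `Λ = box n y ⊂ ℤ^d` with sides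
`n_i ≤ K`, the comb tree `treeBonds n y`, real bond functions `B : Cfg d` with `B = 0` on the tree, plaquette variable
`B6TreeGaugePoincare.curl`).  For every bond `b = ⟨x, x + e_μ⟩ ∈ Λ`:
* `bond_sq_le_sum`: `|B(b)|² ≤ (d − 1)(K − 1) Σ_{p∈Λ} |(∂B)(p)|²` — the pointwise half of the "simple argument of Lemma
  2.4 [11]" (`B16Eq18Proof.bond_sq_le`: comb telescoping + Cauchy–Schwarz) followed by the observation that the comb
  path of ONE bond meets each plaquette at most once (`B16Eq18Proof.sum_seg_le_indicator`), so no multiplicity count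
  is needed (this is the "simpler inequality" of p. 383);
* **`ineq178_box`** = (1.78) AS TYPED: `B16Sect1Kernels.Ineq178 (B(b)²) (Σ_{p∈Λ}|(∂B)(p)|²) M L N^{β₀} R_j d` whenever
  `K ≤ 100M(L+1)N^{β₀}R_j` (`(d−1)(K−1) ≤ 6(d+3)D^{d+2}` for `K ≤ D`, `1 ≤ D`); `ineq178_box_vec`: 𝔤-valued `B`
  componentwise in an orthonormal basis (the row's reading).

HONEST SCOPE.  Model = one box in its comb gauge (the (1.8) setting; the print's region `𝐁₀ ∩ Ω″~_{h+1}` carries the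
nested generalized axial gauge of [IV] §1 — one annulus of it is the carrier of `B16Ineq178TreeGauge`).  The constant
`6(d+3)(·)^{d+2}` is met with room, not explained.  Every declaration is a proved theorem; no new definition, no
hypothesis beyond the printed tree gauge.  Unit `lit-balaban-r13` (literature-prover-lit-balaban-r13-g5-0).
-/

open Finset

namespace Literature.MathematicalPhysics.QuantumFieldTheory.Balaban1983to89.B16Ineq178Box

open B16Eq18Proof
open B6TreeGaugePoincare (Cfg curl seg segCurl OnSeg)

noncomputable section

variable {d : ℕ} {n : Fin d → ℕ}

/-- The comb path of one bond meets each plaquette of `Λ` at most once: `Σ_{j<μ} Σ_{x′ on the j-th segment}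
|(∂B)(p(x′))|² ≤ Σ_{p∈Λ} |(∂B)(p)|²` (the "simpler inequality" of p. 383 — no multiplicity count). [cite: Balaban1989LargeFieldII, (1.78) p.383] -/
theorem path_sq_le_sum {y x : Fin d → ℤ} (hx : x ∈ box n y) (μ : Fin d) (hμ : x μ + 1 < y μ + n μ) (B : Cfg d) :
    ∑ j ∈ univ.filter (· < μ), ∑ s ∈ range (x j - y j).toNat, segCurl B y x j μ s ^ 2 ≤
      ∑ p ∈ innerPlaq n y, curl B p.1 p.2.1 p.2.2 ^ 2 := by
  rw [sum_innerPlaq_eq y (fun z j ν => curl B z j ν ^ 2)]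
  refine le_trans (sum_le_sum fun j hj => ?_)
    (single_le_sum (f := fun ν => ∑ j ∈ univ.filter (· < ν), ∑ z ∈ plaqStarts n y j ν, curl B z j ν ^ 2)
      (fun ν _ => sum_nonneg fun _ _ => sum_nonneg fun _ _ => sq_nonneg _) (mem_univ μ))
  have hjμ : j < μ := (mem_filter.1 hj).2
  refine le_trans (sum_seg_le_indicator hx hjμ hμ (fun z => curl B z j μ ^ 2) fun _ => sq_nonneg _)
    (sum_le_sum fun z _ => ?_)
  split_ifs
  · exact le_rfl
  · exact sq_nonneg _

/-- **One bond, (1.8) carrier**: in the comb gauge on the box `Λ` with sides `n_i ≤ K`, every bond `⟨x, x + e_μ⟩ ∈ Λ`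
has `|B(x, x + e_μ)|² ≤ (d − 1)(K − 1) Σ_{p∈Λ} |(∂B)(p)|²`. [cite: Balaban1989LargeFieldII, (1.78) p.383] -/
theorem bond_sq_le_sum {K : ℕ} {y x : Fin d → ℤ} (hx : x ∈ box n y) (hK : ∀ i, n i ≤ K) (μ : Fin d)
    (hμ : x μ + 1 < y μ + n μ) (B : Cfg d) (hB : ∀ b ∈ treeBonds n y, B b = 0) :
    B (x, μ) ^ 2 ≤ ((d : ℝ) - 1) * ((K : ℝ) - 1) * ∑ p ∈ innerPlaq n y, curl B p.1 p.2.1 p.2.2 ^ 2 := by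
  have hKμ : 1 ≤ K := by
    have h1 := (mem_box.1 hx μ).1
    have h2 := hK μ
    omega
  have hd' : (0 : ℝ) ≤ (d : ℝ) - 1 := by
    have : (1 : ℝ) ≤ d := by exact_mod_cast Nat.succ_le_of_lt (lt_of_le_of_lt (Nat.zero_le _) μ.2)
    linarith
  have hK' : (0 : ℝ) ≤ (K : ℝ) - 1 := by
    have : (1 : ℝ) ≤ K := by exact_mod_cast hKμ
    linarith
  exact (bond_sq_le hx hK μ hμ B hB).trans
    (mul_le_mul_of_nonneg_left (path_sq_le_sum hx μ hμ B) (mul_nonneg hd' hK'))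

/-- The printed constant dominates the pointwise one: `(d − 1)(K − 1) ≤ 6(d + 3)D^{d+2}` for `K ≤ D`, `1 ≤ D`. [cite: Balaban1989LargeFieldII, (1.78) p.383] -/
theorem pathConst_le {K : ℕ} {D : ℝ} (hKD : (K : ℝ) ≤ D) (hD : 1 ≤ D) :
    ((d : ℝ) - 1) * ((K : ℝ) - 1) ≤ 6 * ((d : ℝ) + 3) * D ^ (d + 2) := by
  have hd : (0 : ℝ) ≤ d := Nat.cast_nonneg d
  have hpow : D ≤ D ^ (d + 2) := by
    calc D = D ^ 1 := (pow_one D).symm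
      _ ≤ D ^ (d + 2) := pow_le_pow_right₀ hD (by omega)
  have h1 : ((d : ℝ) - 1) * ((K : ℝ) - 1) ≤ ((d : ℝ) + 3) * D := by nlinarith
  have h2 : ((d : ℝ) + 3) * D ≤ ((d : ℝ) + 3) * D ^ (d + 2) := mul_le_mul_of_nonneg_left hpow (by linarith)
  nlinarith [h1, h2, pow_nonneg (by linarith : (0 : ℝ) ≤ D) (d + 2)]

/-- **(1.78) AS TYPED, PROVED on the (1.8) carrier (real `B`)**: if `Λ = box n y` has all sides `n_i ≤ K` with `K ≤
100M(L+1)N^{β₀}R_j` ("contained in a cube of the size" `100M(L+1)N^{β₀}R_j ≥ 100MR_{j−N+1}`, condition (i) of [IV]) and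
`1 ≤ 100M(L+1)N^{β₀}R_j`, and `B = 0` on the comb tree of `Λ`, then every bond `b ∈ Λ` satisfies
`B16Sect1Kernels.Ineq178 |B(b)|² (Σ_{p∈Λ}|(∂B)(p)|²) M L N^{β₀} R_j d`. [cite: Balaban1989LargeFieldII, (1.78) p.383] -/
theorem ineq178_box {K : ℕ} {M L Nβ Rj : ℝ} (hKD : (K : ℝ) ≤ 100 * M * (L + 1) * Nβ * Rj)
    (hD : 1 ≤ 100 * M * (L + 1) * Nβ * Rj) {y x : Fin d → ℤ} (hx : x ∈ box n y) (hK : ∀ i, n i ≤ K)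
    (μ : Fin d) (hμ : x μ + 1 < y μ + n μ) (B : Cfg d) (hB : ∀ b ∈ treeBonds n y, B b = 0) :
    B16Sect1Kernels.Ineq178 (B (x, μ) ^ 2) (∑ p ∈ innerPlaq n y, curl B p.1 p.2.1 p.2.2 ^ 2) M L Nβ Rj d := by
  unfold B16Sect1Kernels.Ineq178
  exact (bond_sq_le_sum hx hK μ hμ B hB).trans
    (mul_le_mul_of_nonneg_right (pathConst_le hKD hD) (sum_nonneg fun _ _ => sq_nonneg _))

/-- **(1.78) AS TYPED, PROVED on the (1.8) carrier — 𝔤-valued `B`** in the coordinates `a : Fin m` of an orthonormal basis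
(`|B(b)|² = Σ_a B_a(b)²`, `(∂B)_a = ∂(B_a)`), each coordinate vanishing on the comb tree. [cite: Balaban1989LargeFieldII, (1.78) p.383] -/
theorem ineq178_box_vec {K m : ℕ} {M L Nβ Rj : ℝ} (hKD : (K : ℝ) ≤ 100 * M * (L + 1) * Nβ * Rj)
    (hD : 1 ≤ 100 * M * (L + 1) * Nβ * Rj) {y x : Fin d → ℤ} (hx : x ∈ box n y) (hK : ∀ i, n i ≤ K)
    (μ : Fin d) (hμ : x μ + 1 < y μ + n μ) (B : (Fin d → ℤ) × Fin d → Fin m → ℝ)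
    (hB : ∀ b ∈ treeBonds n y, B b = 0) :
    B16Sect1Kernels.Ineq178 (∑ a, B (x, μ) a ^ 2)
      (∑ p ∈ innerPlaq n y, ∑ a, curl (fun b => B b a) p.1 p.2.1 p.2.2 ^ 2) M L Nβ Rj d := by
  have hcomp := fun a : Fin m =>
    ineq178_box hKD hD hx hK μ hμ (fun b => B b a) (fun b hb => by simp [hB b hb])
  unfold B16Sect1Kernels.Ineq178 at hcomp ⊢
  calc ∑ a, B (x, μ) a ^ 2
      ≤ ∑ a, 6 * ((d : ℝ) + 3) * (100 * M * (L + 1) * Nβ * Rj) ^ (d + 2) *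
          ∑ p ∈ innerPlaq n y, curl (fun b => B b a) p.1 p.2.1 p.2.2 ^ 2 := sum_le_sum fun a _ => hcomp a
    _ = _ := by rw [← mul_sum, sum_comm]

end

end Literature.MathematicalPhysics.QuantumFieldTheory.Balaban1983to89.B16Ineq178Box
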